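import Literature.GroupTheory.CombinatorialGroupTheory.RandomSclFreeGroupProofs
import HarnessLib

/-!
# Random rigidity of scl (Calegari–Walker 2013): proofs, part 17 — gluing prongs by rank

D. Calegari, A. Walker, *Random rigidity in the free group*, Geom. Topol. 17 (2013)
[CalegariWalker2013], §4.2–§4.3 (Lemma 4.7 and the proof of Prop. 4.2): the tripods are "glued in
pairs along their common boundary joints"; the joints come with the involution `ι`, and at a
joint `J` the tripods having `J` in their boundary can be glued to those having `ιJ`, as many as
the smaller of the two numbers. Abstractly: prongs `P` with a site map `site : P → S` and an
involution `σ` of `S` without fixed sites; we match the fibre over `a` with the fibre over `σ a`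
*by rank* (for an auxiliary numbering of the prongs), which is automatically a partial
involution, and exactly `(#fibre(a) − #fibre(σ a))₊` prongs over `a` stay unglued.

* **`rank_lt_card`, `rank_injOn`, `exists_rank_eq`** — the rank of an element in its fibre is a
  bijection onto `[0, #fibre)`.
* **`exists_rankMatching`** — the partial involution `g` and the count of unglued prongs.
-/

namespace Literature.GroupTheory.CombinatorialGroupTheory

section RankMatching

variable {P S : Type*} [Fintype P] [DecidableEq S]

/-- The rank is less than the size of the fibre. [folklore] -/
theorem rank_lt_card (site : P → S) (idx : P → ℕ) (p : P) :
    (Finset.univ.filter fun p' => site p' = site p ∧ idx p' < idx p).card <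
      (Finset.univ.filter fun p' => site p' = site p).card := by
  classical
  apply Finset.card_lt_card
  rw [Finset.ssubset_iff_of_subset]
  · refine ⟨p, ?_, ?_⟩
    · simp
    · simp
  · intro p' hp'
    rw [Finset.mem_filter] at hp' ⊢
    exact ⟨hp'.1, hp'.2.1⟩

/-- The rank is injective on each fibre (for an injective numbering). [folklore] -/
theorem rank_injOn (site : P → S) (idx : P → ℕ) (hidx : Function.Injective idx) (p p' : P)
    (hs : site p = site p')
    (hr : (Finset.univ.filter fun q => site q = site p ∧ idx q < idx p).card =
      (Finset.univ.filter fun q => site q = site p' ∧ idx q < idx p').card) : p = p' := by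
  classical
  by_contra hne
  have hne' : idx p ≠ idx p' := fun e => hne (hidx e)
  -- the element with the smaller number has strictly smaller rank
  have key : ∀ a b : P, site a = site b → idx a < idx b →
      (Finset.univ.filter fun q => site q = site a ∧ idx q < idx a).card <
        (Finset.univ.filter fun q => site q = site b ∧ idx q < idx b).card := by
    intro a b hab hlt
    apply Finset.card_lt_card
    rw [Finset.ssubset_iff_of_subset]
    · refine ⟨a, ?_, ?_⟩
      · rw [Finset.mem_filter]; exact ⟨Finset.mem_univ _, hab, hlt⟩
      · rw [Finset.mem_filter]; simp
    · intro c hc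
      rw [Finset.mem_filter] at hc ⊢
      exact ⟨hc.1, hc.2.1.trans hab, hc.2.2.trans hlt⟩
  rcases Nat.lt_or_gt_of_ne hne' with hlt | hlt
  · exact absurd hr (Nat.ne_of_lt (key p p' hs hlt))
  · exact absurd hr.symm (Nat.ne_of_lt (key p' p hs.symm hlt))

/-- Every value below the size of a fibre is the rank of an element of the fibre. [folklore] -/
theorem exists_rank_eq (site : P → S) (idx : P → ℕ) (hidx : Function.Injective idx) (a : S)
    (j : ℕ) (hj : j < (Finset.univ.filter fun p' => site p' = a).card) :
    ∃ p, site p = a ∧ (Finset.univ.filter fun q => site q = site p ∧ idx q < idx p).card = j := by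
  classical
  let fibreRank : P → ℕ := fun p =>
    (Finset.univ.filter fun q => site q = site p ∧ idx q < idx p).card
  show ∃ p, site p = a ∧ fibreRank p = j
  set D := Finset.univ.filter fun p' => site p' = a with hD
  have hsub : D.image fibreRank ⊆ Finset.range D.card := by
    intro x hx
    rw [Finset.mem_image] at hx
    obtain ⟨p, hp, rfl⟩ := hx
    rw [hD, Finset.mem_filter] at hp
    rw [Finset.mem_range]
    show fibreRank p < D.card
    have e : D = Finset.univ.filter fun q => site q = site p := by rw [hD, hp.2]
    rw [e]
    exact rank_lt_card site idx p
  have hcard : (Finset.range D.card).card ≤ (D.image fibreRank).card := by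
    rw [Finset.card_range, Finset.card_image_of_injOn]
    intro p hp p' hp' h
    rw [Finset.mem_coe, hD, Finset.mem_filter] at hp hp'
    exact rank_injOn site idx hidx p p' (hp.2.trans hp'.2.symm) h
  have heq := Finset.eq_of_subset_of_card_le hsub hcard
  have hjmem : j ∈ D.image fibreRank := by
    rw [heq, Finset.mem_range]; exact hj
  rw [Finset.mem_image] at hjmem
  obtain ⟨p, hp, hpj⟩ := hjmem
  rw [hD, Finset.mem_filter] at hp
  exact ⟨p, hp.2, hpj⟩

/-- The number of elements of a fibre of rank below `m ≤ #fibre` is `m`. [folklore] -/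
theorem card_filter_rank_lt (site : P → S) (idx : P → ℕ) (hidx : Function.Injective idx) (a : S)
    (m : ℕ) (hm : m ≤ (Finset.univ.filter fun p' => site p' = a).card) :
    (Finset.univ.filter fun p => site p = a ∧
      (Finset.univ.filter fun q => site q = site p ∧ idx q < idx p).card < m).card = m := by
  classical
  let fibreRank : P → ℕ := fun p =>
    (Finset.univ.filter fun q => site q = site p ∧ idx q < idx p).card
  have h : (Finset.univ.filter fun p => site p = a ∧ fibreRank p < m).card =
      (Finset.range m).card := by
    refine Finset.card_bij (fun p _ => fibreRank p) ?_ ?_ ?_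
    · intro p hp
      rw [Finset.mem_filter] at hp
      exact Finset.mem_range.mpr hp.2.2
    · intro p hp p' hp' h
      rw [Finset.mem_filter] at hp hp'
      exact rank_injOn site idx hidx p p' (hp.2.1.trans hp'.2.1.symm) h
    · intro j hj
      rw [Finset.mem_range] at hj
      obtain ⟨p, hp, hpj⟩ := exists_rank_eq site idx hidx a j (lt_of_lt_of_le hj hm)
      refine ⟨p, Finset.mem_filter.mpr ⟨Finset.mem_univ _, hp, ?_⟩, hpj⟩
      show fibreRank p < m
      have e : fibreRank p = j := hpj
      omega
  exact h.trans (Finset.card_range m)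

/-- **Gluing by rank.** Prongs `P` with sites `site : P → S` and an involution `σ` of the sites
moving every site of a prong. Then there is a partial matching `g` of the prongs which is
symmetric, has no fixed point, glues a prong over `a` only to a prong over `σ a`, and leaves
exactly `#fibre(a) − #fibre(σ a)` (truncated subtraction) prongs over `a` unglued.
[cite: CalegariWalker2013, §4.3 (gluing tripods in pairs along joints)] -/
theorem exists_rankMatching [DecidableEq P] (site : P → S) (σ : S → S)
    (hσ : ∀ a, σ (σ a) = a) (hfix : ∀ p, σ (site p) ≠ site p) :
    ∃ g : P → Option P,
      (∀ p p', g p = some p' → g p' = some p) ∧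
      (∀ p p', g p = some p' → site p' = σ (site p)) ∧
      (∀ p, g p ≠ some p) ∧
      (∀ a, (Finset.univ.filter fun p => site p = a ∧ g p = none).card =
        (Finset.univ.filter fun p => site p = a).card -
          (Finset.univ.filter fun p => site p = σ a).card) := by
  classical
  -- an injective numbering of the prongs
  let idx : P → ℕ := fun p => (Fintype.equivFin P p : ℕ)
  have hidx : Function.Injective idx := fun p p' h =>
    (Fintype.equivFin P).injective (Fin.ext h)
  let rk : P → ℕ := fun p =>
    (Finset.univ.filter fun q => site q = site p ∧ idx q < idx p).card
  let g : P → Option P := fun p =>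
    if h : ∃ p', site p' = σ (site p) ∧ rk p' = rk p then some h.choose else none
  have hg_some : ∀ p p', g p = some p' → site p' = σ (site p) ∧ rk p' = rk p := by
    intro p p' h
    by_cases hex : ∃ p', site p' = σ (site p) ∧ rk p' = rk p
    · simp only [g, dif_pos hex, Option.some.injEq] at h
      rw [← h]
      exact hex.choose_spec
    · simp only [g, dif_neg hex] at h
      exact (Option.some_ne_none _ h.symm).elim
  have hg_none : ∀ p, g p = none ↔ ¬ ∃ p', site p' = σ (site p) ∧ rk p' = rk p := by
    intro p
    by_cases hex : ∃ p', site p' = σ (site p) ∧ rk p' = rk p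
    · simp only [g, dif_pos hex]
      simp only [reduceCtorEq, false_iff, not_not]
      exact hex
    · simp only [g, dif_neg hex, true_iff]
      exact hex
  refine ⟨g, ?_, ?_, ?_, ?_⟩
  · -- symmetric
    intro p p' h
    obtain ⟨hs', hr'⟩ := hg_some p p' h
    have hex : ∃ p'', site p'' = σ (site p') ∧ rk p'' = rk p' :=
      ⟨p, by rw [hs', hσ], hr'.symm⟩
    have hgp' : g p' = some hex.choose := by simp only [g, dif_pos hex]
    rw [hgp']
    congr 1
    obtain ⟨hs'', hr''⟩ := hex.choose_spec
    apply rank_injOn site idx hidx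
    · rw [hs'', hs', hσ]
    · exact hr''.trans hr'
  · intro p p' h
    exact (hg_some p p' h).1
  · intro p h
    exact hfix p (hg_some p p h).1.symm
  · -- the unglued prongs over `a` are those of rank `≥ #fibre(σ a)`
    intro a
    set Da := Finset.univ.filter fun p => site p = a with hDa
    set Db := Finset.univ.filter fun p => site p = σ a with hDb
    set m := min Db.card Da.card with hm
    have hchar : ∀ p, site p = a → (g p = none ↔ Db.card ≤ rk p) := by
      intro p hp
      rw [hg_none]
      constructor
      · intro h
        by_contra hlt
        rw [not_le] at hlt
        obtain ⟨p', hp', hr'⟩ := exists_rank_eq site idx hidx (σ a) (rk p) hlt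
        exact h ⟨p', by rw [hp', hp], hr'⟩
      · rintro hle ⟨p', hp', hr'⟩
        have hlt : rk p' < Db.card := by
          have e : Db = Finset.univ.filter fun q => site q = site p' := by rw [hDb, hp', hp]
          rw [e]
          exact rank_lt_card site idx p'
        have e' : rk p' = rk p := hr'
        omega
    -- split the fibre over `a` by `rk < m`
    have hsplit := Finset.card_filter_add_card_filter_not (s := Da) (fun p => rk p < m)
    have h1 : (Da.filter fun p => rk p < m).card = m := by
      have e : (Da.filter fun p => rk p < m) =
          Finset.univ.filter fun p => site p = a ∧
            (Finset.univ.filter fun q => site q = site p ∧ idx q < idx p).card < m := by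
        rw [hDa]
        ext p
        simp [rk]
      rw [e]
      exact card_filter_rank_lt site idx hidx a m (by rw [← hDa]; exact min_le_right _ _)
    have h2 : (Da.filter fun p => ¬ rk p < m) =
        Finset.univ.filter fun p => site p = a ∧ g p = none := by
      ext p
      simp only [hDa, Finset.mem_filter, Finset.mem_univ, true_and]
      constructor
      · rintro ⟨hp, hnot⟩
        refine ⟨hp, (hchar p hp).mpr ?_⟩
        rw [not_lt] at hnot
        have hlt : rk p < Da.card := by
          have e : Da = Finset.univ.filter fun q => site q = site p := by rw [hDa, hp]
          rw [e]
          exact rank_lt_card site idx p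
        rcases le_total Db.card Da.card with hle | hle
        · rw [hm, min_eq_left hle] at hnot; exact hnot
        · omega
      · rintro ⟨hp, hnone⟩
        refine ⟨hp, ?_⟩
        rw [not_lt]
        exact le_trans (min_le_left _ _) ((hchar p hp).mp hnone)
    rw [← h2, ← Nat.add_sub_cancel_left (Da.filter fun p => rk p < m).card
      (Da.filter fun p => ¬ rk p < m).card, hsplit, h1, hm]
    omega

end RankMatching

end Literature.GroupTheory.CombinatorialGroupTheory
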